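import Literature.Geometry.Kaehler.ComplexTorusCyclotomicAutomorphismFiniteOrderEndomorphisms
import HarnessLib

/-!
# Exactly `2d` finite-order endomorphisms: the `±u^r` are pairwise distinct — the `ζ_5`-surface has exactly ten
# finite-order endomorphisms (`Aut_tors ≅ μ_10`), the `ζ_3`-curve exactly six (`Aut E_ρ = μ_6`)

Layer `Literature/Geometry/Kaehler`, namespace `Literature.Geometry.Kaehler.ComplexTorus`; lane `lit-hodgefound`
(Track 2 foundations library), Layer A2/A3 junction, row «A2-26(gc)» (self-proposed 2026-08-28, prover seat
`lit-hodgefound-p10`, generation 31, FILE 11).  FILE 10: on `(X, u) ≅ (ℂ^Φ/Φ(𝔞), ζ_d)` with `d` odd and the model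
simple, every endomorphism of finite order is `u^r` or `−u^r` (`r < d`).  THIS FILE counts them: the `2d` elements
`±u^r` are pairwise distinct (`u` has order `d`, FILE 1; and `u^r = −u^s` would give `1 = (u^r)^d = (−u^s)^d = −1`),
so `X` has EXACTLY `2d` endomorphisms of finite order — the torsion `μ(K) = ±ζ_d^r` of `𝓞_K^×` read on `X`.

WHAT IS PROVED (theorems only; no `def`, no instance, no named fact; net debt 0).
* §1 `one_ne_neg_one_matrix` (`#ι ≠ 0`), `pow_ne_neg_pow_of_charpoly_eq_cyclotomic` (`u^r ≠ −u^s`, `d` odd),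
  `card_image_pow_union_image_neg_pow` (the finite set `{u^r} ∪ {−u^r}`, `r < d`, has `2d` elements),
  **`setOf_isOfFinOrder_eq_of_iso`** (`{v ∈ End X | v of finite order}` is that set) and
  **`ncard_setOf_isOfFinOrder_of_iso`** (`= 2d`).
* §2 **`ncard_setOf_isOfFinOrder_five`** (`X` a `2`-dimensional complex torus with an endomorphism of order `5`: EXACTLY
  TEN finite-order endomorphisms), **`ncard_setOf_isOfFinOrder_three`** (a one-dimensional complex torus with an
  endomorphism of order `3`: EXACTLY SIX — «`Aut E = μ_6`» for `j = 0`).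

Sources.  G. Shimura, *Abelian Varieties with Complex Multiplication and Modular Functions* (1998), §5.1 Prop. 6,
p. 37 (`End_ℚ = ι(F)` for simple CM), §8.2 Prop. 26, p. 69; Ch. Birkenhake, H. Lange, *Complex Abelian Varieties*,
2nd ed. (2004), §13.3 — not held (acq-10211), locator as cited by this lane's earlier rows; J. H. Silverman,
*The Arithmetic of Elliptic Curves* (2009), III §10 Thm. 10.1 («`Aut(E) ≅ μ_6` if `j(E) = 0`») as cited by the tree's
elliptic-curve files; J. Brzeziński, *Galois Theory Through Exercises* (2018), Exercise 10.15 (a) (the roots of unity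
of `ℚ(ε_m)`; held, p. 0239).

## References

* [Shimura1998] G. Shimura, *Abelian Varieties with Complex Multiplication and Modular Functions*, Princeton
  Univ. Press (1998), §5.1 Prop. 6 p. 37, §8.2 Prop. 26 p. 69.
* [BirkenhakeLange2004] Ch. Birkenhake, H. Lange, *Complex Abelian Varieties*, 2nd ed., Grundlehren 302 (2004), §13.3.
* [SilvermanAEC2009] J. H. Silverman, *The Arithmetic of Elliptic Curves*, 2nd ed., GTM 106 (2009), III §10 Thm. 10.1.
-/

noncomputable section

open scoped Classical nonZeroDivisors NumberField Manifold ContDiff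
open NumberField Module Polynomial

namespace Literature.Geometry.Kaehler

namespace ComplexTorus

open Literature.AlgebraicGeometry.Motives (CMType)
open Literature.NumberTheory.ComplexMultiplication.CMTypeLattice (periodIso)
-- `CMTypeLattice.mulMatrix I a` (multiplication by `a ∈ 𝓞 K` on the ideal `I`) is spelled with its namespace below:
-- the elliptic-curve files in the import cone declare a `ComplexTorus.mulMatrix` of their own.
open Literature.NumberTheory.ComplexMultiplication (CMTypeLattice.mulMatrix)

/-! ### §1 The `2d` elements `±u^r` are pairwise distinct and exhaust the finite-order endomorphisms -/

section General

variable {ι : Type} [Fintype ι] [DecidableEq ι] {E : Type} [NormedAddCommGroup E] [NormedSpace ℂ E]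
  {P : (ι → ℝ) ≃L[ℝ] E} {d : ℕ} [NeZero d] {K : Type} [Field K] [NumberField K]
  [IsCyclotomicExtension {d} ℚ K] {ζ : K} (hζ : IsPrimitiveRoot ζ d)

omit [Fintype ι] [DecidableEq ι] in
/-- `1 ≠ −1` in `M_ι(ℤ)` for `ι` nonempty. [folklore] -/
private theorem one_ne_neg_one_matrix [DecidableEq ι] [Nonempty ι] : (1 : Matrix ι ι ℤ) ≠ -1 := by
  intro h
  obtain ⟨i⟩ := ‹Nonempty ι›
  have h1 := congr_fun (congr_fun h i) i
  rw [Matrix.neg_apply, Matrix.one_apply_eq] at h1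
  omega

omit [NeZero d] in
/-- **`u^r ≠ −u^s`** for an endomorphism with `P_u = Φ_d`, `d` odd: `d`-th powers give `1 = −1` in `M_ι(ℤ)`
(`#ι = φ(d) ≠ 0`). [cite: BirkenhakeLange2004, §13.3] -/
theorem pow_ne_neg_pow_of_charpoly_eq_cyclotomic [NeZero d] (hodd : Odd d) {A : Matrix ι ι ℤ}
    (hP : A.charpoly = cyclotomic d ℤ) (r s : ℕ) : A ^ r ≠ -(A ^ s) := by
  haveI : Nonempty ι := by
    rw [← Fintype.card_pos_iff, card_eq_totient_of_charpoly_eq_cyclotomic hP]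
    exact Nat.totient_pos.2 (NeZero.pos d)
  intro h
  have hAd : A ^ d = 1 := pow_eq_one_of_charpoly_eq_cyclotomic hP
  have h1 : (A ^ r) ^ d = 1 := by rw [pow_right_comm, hAd, one_pow]
  have h2 : (-(A ^ s)) ^ d = -1 := by rw [hodd.neg_pow, pow_right_comm, hAd, one_pow]
  rw [h, h2] at h1
  exact one_ne_neg_one_matrix h1.symm

/-- **The `2d` elements `u^r`, `−u^r` (`r < d`) are pairwise distinct**: as a finite set they number `2d` (`u` has
order `d`, FILE 1 `orderOf_eq_of_charpoly_eq_cyclotomic`; `u^r ≠ −u^s`). [cite: BirkenhakeLange2004, §13.3] -/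
theorem card_image_pow_union_image_neg_pow (hodd : Odd d) {A : Matrix ι ι ℤ} (hA : A ∈ endRingInt P)
    (hP : A.charpoly = cyclotomic d ℤ) :
    ((Finset.range d).image (fun r ↦ A ^ r) ∪ (Finset.range d).image (fun r ↦ -(A ^ r))).card = 2 * d := by
  have hord : orderOf A = d := orderOf_eq_of_charpoly_eq_cyclotomic hA hP
  have hinj : Set.InjOn (fun r ↦ A ^ r) (Finset.range d : Set ℕ) := by
    intro r hr s hs h
    rw [Finset.coe_range, Set.mem_Iio, ← hord] at hr hs
    exact pow_injOn_Iio_orderOf hr hs h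
  have hinj' : Set.InjOn (fun r ↦ -(A ^ r)) (Finset.range d : Set ℕ) :=
    fun r hr s hs h ↦ hinj hr hs (neg_injective h)
  rw [Finset.card_union_of_disjoint, Finset.card_image_of_injOn hinj, Finset.card_image_of_injOn hinj',
    Finset.card_range, two_mul]
  rw [Finset.disjoint_left]
  intro v hv hv'
  simp only [Finset.mem_image, Finset.mem_range] at hv hv'
  obtain ⟨r, -, rfl⟩ := hv
  obtain ⟨s, -, hs⟩ := hv'
  exact pow_ne_neg_pow_of_charpoly_eq_cyclotomic hodd hP r s hs.symm

/-- **THE FINITE-ORDER ENDOMORPHISMS OF `X` ARE EXACTLY `{u^r} ∪ {−u^r}`, `r < d`** (`d` odd, `(X, u) ≅ (ℂ^Φ/Φ(𝔞), ζ_d)`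
with the model simple): FILE 10 gives `⊆`; conversely `u^r`, `−u^r ∈ End X` have finite order (`(±u^r)^{2d} = 1`).
[cite: Shimura1998, §5.1 Prop. 6 p. 37, §8.2 Prop. 26 p. 69] [cite: BirkenhakeLange2004, §13.3] -/
theorem setOf_isOfFinOrder_eq_of_iso (hodd : Odd d) {A : Matrix ι ι ℤ} (hA : A ∈ endRingInt P)
    (hP : A.charpoly = cyclotomic d ℤ) {Φ : CMType K} {I : (FractionalIdeal (𝓞 K)⁰ K)ˣ}
    (hS : ComplexTorus.IsSimple (periodIso Φ I)) (e : ComplexTorus P ≃+ ComplexTorus (periodIso Φ I))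
    (he : ContMDiff 𝓘(ℂ, E) 𝓘(ℂ, Φ.1 → ℂ) ω e) (he₂ : ContMDiff 𝓘(ℂ, Φ.1 → ℂ) 𝓘(ℂ, E) ω e.symm)
    (hcomm : ∀ x : ComplexTorus P,
      e (mapMatrix P P A x) = mapMatrix (periodIso Φ I) (periodIso Φ I) (CMTypeLattice.mulMatrix I hζ.toInteger) (e x)) :
    {v : Matrix ι ι ℤ | v ∈ endRingInt P ∧ IsOfFinOrder v} =
      ↑((Finset.range d).image (fun r ↦ A ^ r) ∪ (Finset.range d).image (fun r ↦ -(A ^ r))) := by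
  have hAd : A ^ d = 1 := pow_eq_one_of_charpoly_eq_cyclotomic hP
  have hArd : ∀ r, (A ^ r) ^ d = 1 := fun r ↦ by rw [pow_right_comm, hAd, one_pow]
  have hfinpow : ∀ r, IsOfFinOrder (A ^ r) := fun r ↦ isOfFinOrder_iff_pow_eq_one.2 ⟨d, NeZero.pos d, hArd r⟩
  have hfinneg : ∀ r, IsOfFinOrder (-(A ^ r)) := fun r ↦
    isOfFinOrder_iff_pow_eq_one.2 ⟨2 * d, Nat.mul_pos two_pos (NeZero.pos d), by
      rw [(even_two_mul d).neg_pow, mul_comm, pow_mul, hArd, one_pow]⟩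
  ext v
  simp only [Set.mem_setOf_eq, Finset.coe_union, Finset.coe_image, Finset.coe_range, Set.mem_union, Set.mem_image,
    Set.mem_Iio]
  constructor
  · rintro ⟨hv, hfin⟩
    obtain ⟨r, hr, h | h⟩ := exists_eq_pow_or_neg_pow_of_isOfFinOrder_of_iso hζ hodd hS e he he₂ hcomm hv hfin
    · exact Or.inl ⟨r, hr, h.symm⟩
    · exact Or.inr ⟨r, hr, h.symm⟩
  · rintro (⟨r, -, rfl⟩ | ⟨r, -, rfl⟩)
    · exact ⟨Subring.pow_mem _ hA r, hfinpow r⟩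
    · exact ⟨Subring.neg_mem _ (Subring.pow_mem _ hA r), hfinneg r⟩

/-- **`X` HAS EXACTLY `2d` ENDOMORPHISMS OF FINITE ORDER** (`d` odd, `(X, u) ≅ (ℂ^Φ/Φ(𝔞), ζ_d)`, the model simple) —
the `±u^r`, i.e. the roots of unity `±ζ_d^r` of `𝓞_K` acting on `X`. [cite: Shimura1998, §5.1 Prop. 6, p. 37]
[cite: BirkenhakeLange2004, §13.3] -/
theorem ncard_setOf_isOfFinOrder_of_iso (hodd : Odd d) {A : Matrix ι ι ℤ} (hA : A ∈ endRingInt P)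
    (hP : A.charpoly = cyclotomic d ℤ) {Φ : CMType K} {I : (FractionalIdeal (𝓞 K)⁰ K)ˣ}
    (hS : ComplexTorus.IsSimple (periodIso Φ I)) (e : ComplexTorus P ≃+ ComplexTorus (periodIso Φ I))
    (he : ContMDiff 𝓘(ℂ, E) 𝓘(ℂ, Φ.1 → ℂ) ω e) (he₂ : ContMDiff 𝓘(ℂ, Φ.1 → ℂ) 𝓘(ℂ, E) ω e.symm)
    (hcomm : ∀ x : ComplexTorus P,
      e (mapMatrix P P A x) = mapMatrix (periodIso Φ I) (periodIso Φ I) (CMTypeLattice.mulMatrix I hζ.toInteger) (e x)) :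
    {v : Matrix ι ι ℤ | v ∈ endRingInt P ∧ IsOfFinOrder v}.ncard = 2 * d := by
  rw [setOf_isOfFinOrder_eq_of_iso hζ hodd hA hP hS e he he₂ hcomm, Set.ncard_coe_finset,
    card_image_pow_union_image_neg_pow hodd hA hP]

end General

/-! ### §2 The `ζ_5`-surface has exactly ten finite-order endomorphisms, the `ζ_3`-curve exactly six -/

section Examples

variable {ι : Type} [Fintype ι] [DecidableEq ι] {E : Type} [NormedAddCommGroup E] [NormedSpace ℂ E]
  {P : (ι → ℝ) ≃L[ℝ] E}

set_option backward.isDefEq.respectTransparency false in -- Mathlib's instance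
-- `IsCyclotomicExtension {5} ℚ (CyclotomicField 5 ℚ)` is keyed on `CyclotomicField.algebra`, the goal on
-- `DivisionRing.toRatAlgebra` (same workaround as FILE 1 `isAbelianVariety_of_charpoly_eq_cyclotomic`)
/-- **THE `ζ_5`-SURFACE HAS EXACTLY TEN ENDOMORPHISMS OF FINITE ORDER** (the `±u^r`; `X` a `2`-dimensional complex
torus with an endomorphism `u` of order `5`). [cite: Shimura1998, §5.1 Prop. 6 p. 37, §8.4 (2) p. 73]
[cite: BirkenhakeLange2004, §13.3] -/
theorem ncard_setOf_isOfFinOrder_five {A : Matrix ι ι ℤ} (hA : A ∈ endRingInt P) (hord : orderOf A = 5)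
    (hdim : finrank ℂ E = 2) : {v : Matrix ι ι ℤ | v ∈ endRingInt P ∧ IsOfFinOrder v}.ncard = 10 := by
  have hζ := IsCyclotomicExtension.zeta_spec 5 ℚ (CyclotomicField 5 ℚ)
  have hP : A.charpoly = cyclotomic 5 ℤ :=
    charpoly_eq_cyclotomic_of_orderOf_eq_of_finrank P Nat.prime_five.isPrimePow hord
      (by rw [hdim, Nat.totient_prime Nat.prime_five])
  obtain ⟨Φ, e, he, he', hcomm⟩ := exists_iso_periodIso_one_of_orderOf_eq_five hζ hA hord hdim
  exact ncard_setOf_isOfFinOrder_of_iso hζ (by decide) hA hP (isSimple_periodIso_five Φ 1) e he he' hcomm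

set_option backward.isDefEq.respectTransparency false in -- see above
/-- **THE `ζ_3`-CURVE HAS EXACTLY SIX ENDOMORPHISMS OF FINITE ORDER** («`Aut(E) ≅ μ_6` if `j(E) = 0`»; `X` a
one-dimensional complex torus with an endomorphism `u` of order `3`; the six are `±u^r`).
[cite: SilvermanAEC2009, III §10 Thm. 10.1] [cite: BirkenhakeLange2004, §13.3 Cor. 13.3.4] -/
theorem ncard_setOf_isOfFinOrder_three {A : Matrix ι ι ℤ} (hA : A ∈ endRingInt P) (hord : orderOf A = 3)
    (hdim : finrank ℂ E = 1) : {v : Matrix ι ι ℤ | v ∈ endRingInt P ∧ IsOfFinOrder v}.ncard = 6 := by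
  have hζ := IsCyclotomicExtension.zeta_spec 3 ℚ (CyclotomicField 3 ℚ)
  have h2 : finrank ℚ (CyclotomicField 3 ℚ) = 2 := by
    rw [IsCyclotomicExtension.finrank (n := 3) (CyclotomicField 3 ℚ) (cyclotomic.irreducible_rat (by norm_num)),
      Nat.totient_prime Nat.prime_three]
  have hP : A.charpoly = cyclotomic 3 ℤ :=
    charpoly_eq_cyclotomic_of_orderOf_eq_of_finrank P Nat.prime_three.isPrimePow hord
      (by rw [hdim, Nat.totient_prime Nat.prime_three])
  obtain ⟨Φ, e, he, he', hcomm⟩ := exists_iso_periodIso_one_of_orderOf_eq_three hζ hA hord hdim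
  exact ncard_setOf_isOfFinOrder_of_iso hζ (by decide) hA hP (isSimple_periodIso_of_finrank_eq_two h2 Φ 1) e he he'
    hcomm

end Examples

end ComplexTorus

end Literature.Geometry.Kaehler
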